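import Summits.QuantumFields.YangMills.Theorems.SwapVirialDeficitBlowUpGnomonicHubShiftSmooth
import HarnessLib

/-!
# Route `SwapVirialDeficit` (YangMills): THE ANGLE CHART OF THE HUB — the hub unit `A(θ) = cos θ + sin θ·i` as a SMOOTH letter through the apex `θ = 0`
# (definitions + API; cell ym-idea-1, skeleton ➎ `stub_core_tip` brick (T2-hub) of w2 g60's plan, LEAD memo10b: the tip slab is matched to the adjacent bulk shell by
# moving the HUB ANGLE, through the apex where ✓`gnoDeficit_realHub_rot` (isotropy) acts; free-hands support of ⟨stmt-QuantumFields-24197⟩ `SwapVirialDeficit.SwapGluedStiffness`)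

The gnomonic deficit `F̂ = gnoDeficit z χ a ε η` sees the hub `a` only through the arranged unit `ν(axisPoint a) = cos ψ + sin ψ·i`, `ψ ∈ [0, π]` the hub angle
(`cos ψ = re a∕‖a‖`, `sin ψ = ‖im a‖∕‖a‖`).  As a function of the hub QUATERNION the chart has a kink at the real axis (`‖im a‖` is not differentiable there), but as a
function of the ANGLE it is real-analytic through `ψ = 0`: this file introduces the angle letter.
* §1 `angUnit θ = ⟨cos θ, sin θ, 0, 0⟩`, its norm, components, smoothness and derivative `A′ = A(· + π∕2)`;
* §2 `angChartPoint θ ε η` — the leader ∕ follower configuration `((Q x̂, Q(Ā(θ)·x̂·A(θ)·ẑ), Q ŷ, Q A(θ)), (Q η̂_f)_f)` — and `gnoDeficitAng z χ θ ε η := F_z(angChartPoint θ ε η)`,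
  defined and smooth for EVERY `θ ∈ ℝ`;
* §3 the identification with the gnomonic chart on `sin θ ≥ 0`: `radialUnit_axisPoint_angUnit`, ★ `blowUpPoint_gnomonicPoint_angUnit`, ★★ `gnoDeficit_angUnit`
  (`gnoDeficit z χ (angUnit θ) ε η = gnoDeficitAng z χ θ ε η`), and ★★ `exists_hubAngle` ∕ `gnoDeficit_eq_gnoDeficitAng`: every hub `a ≠ 0` has an angle
  `θ ∈ [0, π]` with `ν(axisPoint a) = angUnit θ`, `sin²θ = hubS2 a`-data, and `gnoDeficit z χ a ε η = gnoDeficitAng z χ θ ε η` for all `ε, η`.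
The jets of `(θ, η) ↦ gnoDeficitAng` along joint angle–letter lines (K7d twin with hub speed measured in the ANGLE, uniform down to the apex) and the hub-angle
Lipschitz law of the follower Hessian are the sequel `…GnomonicTaylorAngleLine`.

HONEST LABEL: definitions and identities only; `stub_core_tip`, the other region stubs, ⟨24197⟩ ∕ ⟨24194⟩ OPEN; own crux ⟨22884⟩ `LargeFieldMassRefinementTail` OPEN
(blocked-on ⟨19935⟩); the Yang–Mills mass gap is NOT proved; no summit is proved by a line.  No instance, no notation, 0 `sorry`, standard axioms.
Width seat ym-line-sfw-p2-w2 g60 (cell ym-idea-1, free hands), `--supports stmt-QuantumFields-24197`.  References: [cite: Luscher1983, §2]; [folklore].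
-/

set_option autoImplicit false
set_option synthInstance.maxSize 1024

noncomputable section

open Quaternion Set
open scoped Quaternion BigOperators ContDiff
open Literature.MathematicalPhysics.QuantumLattice
open Literature.MathematicalPhysics.QuantumFieldTheory hiding SU2
open Literature.Analysis.Calculus (radialUnit radialUnit_def norm_radialUnit)
open Summit.QuantumFields.YangMills.Theorems.FemtoTransferGap
open Summit.QuantumFields.YangMills.Theorems.FemtoTransferGap.TT
open Summit.QuantumFields.YangMills.Theorems.SwapTwistDeficit.ToronLog (axisPoint)
open Summit.QuantumFields.YangMills.Theorems.SwapVirialDeficit.ZeroModeSigma (su2Quat_quatToSU2_eq_radialUnit slaveP slaveP_def norm_axisUnit dil3 dil3_apply)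
open Summit.QuantumFields.YangMills.Theorems.SwapVirialDeficit.BlowUp (leaderTuple leaderTuple_apply dil3_one' dilateIm_one_apply)

namespace Summit.QuantumFields.YangMills.Theorems.SwapVirialDeficit.BlowUpRing

variable {L : ℕ} [NeZero L]

/-! ## §1 The hub unit on the angle circle -/

/-- THE HUB UNIT AT ANGLE `θ`: `A(θ) = cos θ + sin θ·i` (the arranged seam letter `ν(axisPoint a)` of a hub with angle `θ = ψ(a) ∈ [0, π]`; here for every real `θ`).
[folklore] -/
def angUnit (θ : ℝ) : ℍ := ⟨Real.cos θ, Real.sin θ, 0, 0⟩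

/-- Components of the hub unit. [folklore] -/
theorem angUnit_re (θ : ℝ) : (angUnit θ).re = Real.cos θ := rfl

/-- Components of the hub unit. [folklore] -/
theorem angUnit_imI (θ : ℝ) : (angUnit θ).imI = Real.sin θ := rfl

/-- Components of the hub unit. [folklore] -/
theorem angUnit_imJ (θ : ℝ) : (angUnit θ).imJ = 0 := rfl

/-- Components of the hub unit. [folklore] -/
theorem angUnit_imK (θ : ℝ) : (angUnit θ).imK = 0 := rfl

/-- The hub unit as a combination of `1` and `i = A(π∕2)`: `A(θ) = cos θ • 1 + sin θ • A(π∕2)`. [folklore] -/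
theorem angUnit_eq_smul (θ : ℝ) : angUnit θ = Real.cos θ • (1 : ℍ) + Real.sin θ • angUnit (Real.pi / 2) := by
  ext <;> simp [angUnit]

/-- `‖A(θ)‖ = 1`. [folklore] -/
theorem norm_angUnit (θ : ℝ) : ‖angUnit θ‖ = 1 := by
  have h : ‖angUnit θ‖ ^ 2 = 1 := by
    rw [sq, ← Quaternion.normSq_eq_norm_mul_self, Quaternion.normSq_def']
    simp [angUnit, Real.cos_sq_add_sin_sq]
  have h0 : 0 ≤ ‖angUnit θ‖ := norm_nonneg _
  nlinarith

/-- `A(θ) ≠ 0`. [folklore] -/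
theorem angUnit_ne_zero (θ : ℝ) : angUnit θ ≠ 0 := fun h => by
  have h1 := norm_angUnit θ
  rw [h, norm_zero] at h1
  exact zero_ne_one h1

/-- The imaginary part of the hub unit and its norm: `‖im A(θ)‖ = |sin θ|`. [folklore] -/
theorem norm_im_angUnit (θ : ℝ) : ‖(angUnit θ).im‖ = |Real.sin θ| := by
  have h : ‖(angUnit θ).im‖ ^ 2 = Real.sin θ ^ 2 := by
    rw [sq, ← Quaternion.normSq_eq_norm_mul_self, Quaternion.normSq_def']
    simp [angUnit]
  rw [← Real.sqrt_sq (norm_nonneg _), h, Real.sqrt_sq_eq_abs]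

/-- ★ **THE HUB UNIT IS SMOOTH IN THE ANGLE** (through the apex `θ = 0`). [folklore] -/
theorem contDiff_angUnit {n : WithTop ℕ∞} : ContDiff ℝ n angUnit := by
  have e : angUnit = fun θ => Real.cos θ • (1 : ℍ) + Real.sin θ • angUnit (Real.pi / 2) := funext angUnit_eq_smul
  rw [e]
  exact (Real.contDiff_cos.smul contDiff_const).add (Real.contDiff_sin.smul contDiff_const)

/-- ★ **THE DERIVATIVE OF THE HUB UNIT ALONG AN AFFINE ANGLE** is the quarter-turned unit: `d∕ds A(θ₀ + sθ₁ + c) = θ₁ • A(θ₀ + sθ₁ + c + π∕2)`. [folklore] -/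
theorem hasDerivAt_angUnit_affine (θ₀ θ₁ c s : ℝ) :
    HasDerivAt (fun s : ℝ => angUnit (θ₀ + s * θ₁ + c)) (θ₁ • angUnit (θ₀ + s * θ₁ + c + Real.pi / 2)) s := by
  have hφ : HasDerivAt (fun s : ℝ => θ₀ + s * θ₁ + c) θ₁ s := by
    have h := ((hasDerivAt_id s).mul_const θ₁).const_add θ₀
    simpa using h.add_const c
  have hcos := (hφ.cos).smul_const (1 : ℍ)
  have hsin := (hφ.sin).smul_const (angUnit (Real.pi / 2))
  have h := hcos.add hsin
  have e : (fun s : ℝ => angUnit (θ₀ + s * θ₁ + c)) = fun s => Real.cos (θ₀ + s * θ₁ + c) • (1 : ℍ) + Real.sin (θ₀ + s * θ₁ + c) • angUnit (Real.pi / 2) :=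
    funext fun s => angUnit_eq_smul _
  rw [e]
  have heq : (-Real.sin (θ₀ + s * θ₁ + c) * θ₁) • (1 : ℍ) + (Real.cos (θ₀ + s * θ₁ + c) * θ₁) • angUnit (Real.pi / 2) =
      θ₁ • angUnit (θ₀ + s * θ₁ + c + Real.pi / 2) := by
    rw [angUnit_eq_smul (θ₀ + s * θ₁ + c + Real.pi / 2), Real.cos_add_pi_div_two, Real.sin_add_pi_div_two]
    ext <;> simp [angUnit] <;> ring
  exact h.congr_deriv heq

/-! ## §2 The angle chart point and its deficit -/

/-- THE CONFIGURATION OF THE ANGLE CHART: leaders `(Q x̂, Q(Ā(θ)·x̂·A(θ)·ẑ), Q ŷ, Q A(θ))` (the tuple ✓`leaderTuple` with the hub unit `A(θ)` in place of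
`ν(axisPoint a)`) and followers `Q η̂_f` — for EVERY real `θ`. [cite: Luscher1983, §2] -/
def angChartPoint (θ : ℝ) (ε : GnoSign L) (η : GnoCoord L) : (Fin 4 → SU2) × (Fol L → SU2) :=
  (![quatToSU2 (gnoLetter ε.1.1 η.1.1), quatToSU2 (slaveP (angUnit θ) (gnoLetter ε.1.1 η.1.1) * gnoLetter ε.2.1 η.2.1),
      quatToSU2 (gnoLetter ε.1.2 η.1.2), quatToSU2 (angUnit θ)],
    fun i => quatToSU2 (gnoLetter (ε.2.2 i) (η.2.2 i)))

/-- THE σ-GLUED DEFICIT IN THE ANGLE CHART: `F̂(θ; ε, η) = F_z(angChartPoint θ ε η)`, a function on `ℝ × GnoCoord L` (smooth in BOTH arguments, sequel). [cite: Luscher1983, §2] -/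
def gnoDeficitAng (z : Fin 3 → Bool) (χ : Site 3 L → SU2) (θ : ℝ) (ε : GnoSign L) (η : GnoCoord L) : ℝ :=
  chartDeficit L z χ (angChartPoint θ ε η)

omit [NeZero L] in
/-- The leaders of the angle chart point, one by one. [folklore] -/
theorem angChartPoint_fst_apply (θ : ℝ) (ε : GnoSign L) (η : GnoCoord L) :
    (angChartPoint θ ε η).1 0 = quatToSU2 (gnoLetter ε.1.1 η.1.1) ∧
      (angChartPoint θ ε η).1 1 = quatToSU2 (slaveP (angUnit θ) (gnoLetter ε.1.1 η.1.1) * gnoLetter ε.2.1 η.2.1) ∧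
      (angChartPoint θ ε η).1 2 = quatToSU2 (gnoLetter ε.1.2 η.1.2) ∧ (angChartPoint θ ε η).1 3 = quatToSU2 (angUnit θ) :=
  ⟨rfl, rfl, rfl, rfl⟩

omit [NeZero L] in
/-- The followers of the angle chart point (they do not see the hub). [folklore] -/
theorem angChartPoint_snd_apply (θ : ℝ) (ε : GnoSign L) (η : GnoCoord L) (i : Fol L) :
    (angChartPoint θ ε η).2 i = quatToSU2 (gnoLetter (ε.2.2 i) (η.2.2 i)) := rfl

/-- `0 ≤ F̂(θ; ε, η)`. [cite: Luscher1983, §2] -/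
theorem gnoDeficitAng_nonneg (z : Fin 3 → Bool) (χ : Site 3 L → SU2) (θ : ℝ) (ε : GnoSign L) (η : GnoCoord L) : 0 ≤ gnoDeficitAng z χ θ ε η :=
  chartDeficit_nonneg z χ _

/-! ## §3 Identification with the gnomonic chart on `sin θ ≥ 0` -/

omit [NeZero L] in
/-- For `sin θ ≥ 0` the hub `angUnit θ` is its own arranged unit: `ν(axisPoint (angUnit θ)) = angUnit θ`. [folklore] -/
theorem radialUnit_axisPoint_angUnit {θ : ℝ} (h : 0 ≤ Real.sin θ) : radialUnit (axisPoint (angUnit θ)) = angUnit θ := by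
  have hax : axisPoint (angUnit θ) = angUnit θ := by
    rw [axisPoint, norm_im_angUnit, abs_of_nonneg h]; rfl
  rw [hax, radialUnit_def, norm_angUnit, inv_one, one_smul]

omit [NeZero L] in
/-- ★ **THE GNOMONIC CHART POINT AT THE HUB `angUnit θ` IS THE ANGLE CHART POINT** (`sin θ ≥ 0`). [folklore] -/
theorem blowUpPoint_gnomonicPoint_angUnit {θ : ℝ} (h : 0 ≤ Real.sin θ) (ε : GnoSign L) (η : GnoCoord L) :
    blowUpPoint (L := L) 1 (gnomonicPoint (angUnit θ) ε η) = angChartPoint θ ε η := by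
  rw [blowUpPoint_one_gnomonicPoint]
  refine Prod.ext ?_ rfl
  funext μ
  show leaderTuple (angUnit θ) ((gnoLetter ε.1.1 η.1.1, gnoLetter ε.1.2 η.1.2), gnoLetter ε.2.1 η.2.1) μ = (angChartPoint θ ε η).1 μ
  unfold leaderTuple angChartPoint
  rw [radialUnit_axisPoint_angUnit h]

/-- ★★ **THE GNOMONIC DEFICIT AT THE HUB `angUnit θ` IS THE ANGLE DEFICIT** (`sin θ ≥ 0`): `gnoDeficit z χ (angUnit θ) ε η = gnoDeficitAng z χ θ ε η`. [folklore] -/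
theorem gnoDeficit_angUnit (z : Fin 3 → Bool) (χ : Site 3 L → SU2) {θ : ℝ} (h : 0 ≤ Real.sin θ) (ε : GnoSign L) (η : GnoCoord L) :
    gnoDeficit z χ (angUnit θ) ε η = gnoDeficitAng z χ θ ε η := by
  unfold gnoDeficit gnoDeficitAng
  rw [blowUpPoint_gnomonicPoint_angUnit h]

omit [NeZero L] in
/-- The gnomonic deficit sees the hub only through its arranged unit: hubs with the same `ν(axisPoint ·)` have the same chart points. [folklore] -/
theorem blowUpPoint_gnomonicPoint_eq_of_axisUnit_eq {a a' : ℍ} (h : radialUnit (axisPoint a) = radialUnit (axisPoint a')) (ε : GnoSign L) (η : GnoCoord L) :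
    blowUpPoint (L := L) 1 (gnomonicPoint a ε η) = blowUpPoint (L := L) 1 (gnomonicPoint a' ε η) := by
  rw [blowUpPoint_one_gnomonicPoint, blowUpPoint_one_gnomonicPoint]
  refine Prod.ext ?_ rfl
  funext μ
  unfold leaderTuple
  rw [h]

/-- ★★ **EVERY HUB HAS AN ANGLE**: for `a ≠ 0` there is `θ ∈ [0, π]` with `cos θ = re a∕‖a‖`, `sin θ = ‖im a‖∕‖a‖`, `ν(axisPoint a) = angUnit θ`, and hence
`gnoDeficit z χ a ε η = gnoDeficitAng z χ θ ε η` for all signs and coordinates (so `hubS2 a = sin²θ`, `hubS1 a = sin²2θ` in the ➎ letters). [folklore] -/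
theorem exists_hubAngle {a : ℍ} (ha : a ≠ 0) :
    ∃ θ : ℝ, 0 ≤ θ ∧ θ ≤ Real.pi ∧ Real.cos θ = ‖a‖⁻¹ * a.re ∧ Real.sin θ = ‖a‖⁻¹ * ‖a.im‖ ∧ radialUnit (axisPoint a) = angUnit θ := by
  have hn : 0 < ‖a‖ := norm_pos_iff.2 ha
  have hsq : a.re ^ 2 + ‖a.im‖ ^ 2 = ‖a‖ ^ 2 := by
    have h1 : ‖a‖ ^ 2 = a.re ^ 2 + a.imI ^ 2 + a.imJ ^ 2 + a.imK ^ 2 := by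
      rw [sq, ← Quaternion.normSq_eq_norm_mul_self, Quaternion.normSq_def']
    have h2 : ‖a.im‖ ^ 2 = a.imI ^ 2 + a.imJ ^ 2 + a.imK ^ 2 := by
      rw [sq, ← Quaternion.normSq_eq_norm_mul_self, Quaternion.normSq_def']; simp
    rw [h1, h2]; ring
  set c : ℝ := ‖a‖⁻¹ * a.re with hc
  have hc1 : -1 ≤ c ∧ c ≤ 1 := by
    rw [hc]
    have : |a.re| ≤ ‖a‖ := by
      rw [← Real.sqrt_sq_eq_abs, ← Real.sqrt_sq hn.le]
      exact Real.sqrt_le_sqrt (by nlinarith [sq_nonneg ‖a.im‖])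
    have h' : |‖a‖⁻¹ * a.re| ≤ 1 := by
      rw [abs_mul, abs_of_pos (inv_pos.2 hn), inv_mul_le_iff₀ hn, mul_one]; exact this
    exact abs_le.1 h'
  refine ⟨Real.arccos c, Real.arccos_nonneg c, Real.arccos_le_pi c, Real.cos_arccos hc1.1 hc1.2, ?_, ?_⟩
  · rw [Real.sin_arccos]
    have hu : ‖a‖⁻¹ ^ 2 * ‖a‖ ^ 2 = 1 := by rw [← mul_pow, inv_mul_cancel₀ hn.ne', one_pow]
    have e : 1 - c ^ 2 = (‖a‖⁻¹ * ‖a.im‖) ^ 2 := by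
      rw [hc]; linear_combination (-(‖a‖⁻¹ ^ 2)) * hsq - hu
    rw [e, Real.sqrt_sq (by positivity)]
  · have hu : ‖a‖⁻¹ ^ 2 * ‖a‖ ^ 2 = 1 := by rw [← mul_pow, inv_mul_cancel₀ hn.ne', one_pow]
    have hs : Real.sin (Real.arccos c) = ‖a‖⁻¹ * ‖a.im‖ := by
      rw [Real.sin_arccos]
      have e : 1 - c ^ 2 = (‖a‖⁻¹ * ‖a.im‖) ^ 2 := by
        rw [hc]; linear_combination (-(‖a‖⁻¹ ^ 2)) * hsq - hu
      rw [e, Real.sqrt_sq (by positivity)]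
    have hcos : Real.cos (Real.arccos c) = c := Real.cos_arccos hc1.1 hc1.2
    have hax : ‖axisPoint a‖ = ‖a‖ := by
      have h1 : ‖axisPoint a‖ ^ 2 = a.re ^ 2 + ‖a.im‖ ^ 2 := by
        rw [sq, ← Quaternion.normSq_eq_norm_mul_self, Quaternion.normSq_def']; simp [axisPoint]
      rw [hsq] at h1
      nlinarith [norm_nonneg (axisPoint a), hn]
    rw [radialUnit_def, hax]
    ext
    · show ‖a‖⁻¹ * a.re = Real.cos (Real.arccos c); rw [hcos]
    · show ‖a‖⁻¹ * ‖a.im‖ = Real.sin (Real.arccos c); rw [hs]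
    · show ‖a‖⁻¹ * 0 = 0; rw [mul_zero]
    · show ‖a‖⁻¹ * 0 = 0; rw [mul_zero]

/-- ★★ **THE GNOMONIC DEFICIT OF ANY HUB IS AN ANGLE DEFICIT**: with `θ` the angle of ✓`exists_hubAngle`, `gnoDeficit z χ a ε η = gnoDeficitAng z χ θ ε η`. [folklore] -/
theorem gnoDeficit_eq_gnoDeficitAng (z : Fin 3 → Bool) (χ : Site 3 L → SU2) {a : ℍ} {θ : ℝ} (hθ0 : 0 ≤ θ) (hθπ : θ ≤ Real.pi)
    (h : radialUnit (axisPoint a) = angUnit θ) (ε : GnoSign L) (η : GnoCoord L) :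
    gnoDeficit z χ a ε η = gnoDeficitAng z χ θ ε η := by
  have hs : 0 ≤ Real.sin θ := Real.sin_nonneg_of_nonneg_of_le_pi hθ0 hθπ
  rw [← gnoDeficit_angUnit z χ hs ε η]
  unfold gnoDeficit
  rw [blowUpPoint_gnomonicPoint_eq_of_axisUnit_eq (h.trans (radialUnit_axisPoint_angUnit hs).symm)]

end Summit.QuantumFields.YangMills.Theorems.SwapVirialDeficit.BlowUpRing

end
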